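import Summits.AtomisticToContinuum.FouriersLaw.Theorems.VanishingNoiseTransferVanishingNoiseBoundFlipEndTemperatures
import Literature.Barriers.AtomisticToContinuum.HarmonicCrystalBallistic

/-!
# Bond currents of a weak flip-steady state — no moment hypothesis; the response as an end-temperature slope
(brick for crux stmt-AtomisticToContinuum-11976 `VanishingNoiseTransfer.VanishingNoiseBound`, line
`fekete-usc-one-length`, stub S3 `stub_noisyPositiveConductance`; worker file 3/3)

For the pinned anharmonic chain `P = pinnedChain ω₂ lam β γ` (`ω₂ > 0`, `lam, β ≥ 0`, `γ > 0`), `N ≥ 1` sites,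
bath temperatures `T_L, T_R ≥ 0`, ANY rate `ε` and ANY weak flip steady state `μ` (`IsFlipSteadyState`, no
moment hypothesis; `ε = 0` is the deterministic `IsSteadyState`):

* `integral_bondCurrent_eq` — every genuine bond carries the left reservoir flux:
  `∫ j_i dμ = γ (T_L − ∫ p_0² dμ)` (`i + 1 < N`);
* `totalCurrent_eq_left` / `totalCurrent_eq_right` — `totalCurrent μ = (N−1) γ (T_L − ∫p_0² dμ)
  = (N−1) γ (∫p_{N-1}² dμ − T_R)` (via `OscillatorChain.totalCurrent_eq_of_forall`);
* `stubS3_flipBondCurrents` — the registered sub-goal: the conjunction of the two previous items.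
(The consequences for the response coefficient `D_N` of the stub's frame are in the sequel file
`…FlipResponseFrame.lean`.)

Proof of the first item: weak flip-stationarity on the flip-invariant cut-off block energy `E_{≤i} χ(H/R)`
(`HardTether.leftEnergy`, even in each momentum), whose generator is
`χ(H/R)(γ(T_L − p_0²) − j_i) + (terms supported in {R ≤ H ≤ 2R})`, the latter dominated, uniformly in `R ≥ 1`, by
`C + C'(p_0² + p_{N-1}²) ∈ L¹(μ)` thanks to the end-momentum integrability of file 2/3 and `E_{≤i} ≤ H ≤ 2R`,
`p² ≤ 4R` there; dominated convergence `R → ∞`. References: Bonetto–Lebowitz–Rey-Bellet 2000 §5.2 (25)–(27)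
(all bonds carry the reservoir flux); Bernardin–Olla 2011 §2.1 (flips conserve energy, carry no current).
-/

noncomputable section

namespace Summit.AtomisticToContinuum.FouriersLaw.Theorems.VanishingNoiseBound

open MeasureTheory Filter Topology Set
open scoped ContDiff NNReal ENNReal
open Literature.MathematicalPhysics.KineticTheory
open Literature.MathematicalPhysics.KineticTheory.HeatConduction
open Literature.MathematicalPhysics.KineticTheory.HeatConduction.HardTether
  (leftEnergy blockWeight bondWeight bondCurrent_add_generator_leftEnergy partialP_leftEnergy)
open Summit.AtomisticToContinuum.FouriersLaw.Theorems.SubdiffusiveBondHeat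
open Summit.AtomisticToContinuum.FouriersLaw.Theorems.LinearResponseFTUR

variable {N : ℕ}

/-! ### Every bond carries the left reservoir flux -/

section Pinned

variable {ω₂ lam β γ : ℝ}

/-- **Bond currents of a weak flip steady state.** For the pinned chain (`ω₂ > 0`, `lam, β ≥ 0`, `γ > 0`,
`N ≥ 1`), bath temperatures `T_L, T_R ≥ 0`, any rate `ε`, any weak flip steady state `μ` (no moment
hypothesis) and every genuine bond `i` (`i + 1 < N`): `∫ j_i dμ = γ (T_L − ∫ p_0² dμ)` — weak stationarity on
the flip-invariant cut-off block energies `E_{≤i} χ(H/R)` and dominated convergence `R → ∞`, the shell terms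
being dominated by `C + C'(p_0² + p_{N-1}²) ∈ L¹(μ)` (file 2/3).
[Bonetto–Lebowitz–Rey-Bellet 2000, §5.2 eqs. (25)–(27)] [folklore] -/
theorem integral_bondCurrent_eq (hω : 0 < ω₂) (hl : 0 ≤ lam) (hβ : 0 ≤ β) (hγ : 0 < γ) (hN : 0 < N)
    {T_L T_R : ℝ} (hTL : 0 ≤ T_L) (hTR : 0 ≤ T_R) {ε : ℝ} {μ : Measure (PhaseSpace N)}
    (hμ : (pinnedChain ω₂ lam β γ).IsFlipSteadyState N T_L T_R ε μ) {i : Fin N} (hi : i.val + 1 < N) :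
    ∫ x, (pinnedChain ω₂ lam β γ).bondCurrent N i x ∂μ = γ * (T_L - ∫ x, x.2 ⟨0, hN⟩ ^ 2 ∂μ) := by
  set P := pinnedChain ω₂ lam β γ with hP
  haveI := hμ.isProbabilityMeasure
  have hγ' : P.γ = γ := rfl
  have hU : ContDiff ℝ ∞ P.U := pinnedChain_contDiff_U ω₂ lam β γ
  have hV : ContDiff ℝ ∞ P.V := pinnedChain_contDiff_V ω₂ lam β γ
  have hU2 : ContDiff ℝ 2 P.U := pinnedChain_contDiff_U ω₂ lam β γ
  have hV2 : ContDiff ℝ 2 P.V := pinnedChain_contDiff_V ω₂ lam β γ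
  have hU1 : ContDiff ℝ 1 P.U := pinnedChain_contDiff_U ω₂ lam β γ
  have hV1 : ContDiff ℝ 1 P.V := pinnedChain_contDiff_V ω₂ lam β γ
  have hHs : ContDiff ℝ ∞ (P.hamiltonian N) := P.contDiff_hamiltonian hU hV N
  have hHc : Continuous (P.hamiltonian N) := hHs.continuous
  have hconf : P.IsConfining := pinnedChain_isConfining hω hl hβ hγ.le
  have hU0 : ∀ q, 0 ≤ P.U q := hconf.U_nonneg
  have hV0 : ∀ r, 0 ≤ P.V r := hconf.V_nonneg
  have hcpt : ∀ E : ℝ, IsCompact {x : PhaseSpace N | P.hamiltonian N x ≤ E} :=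
    pinnedChain_isCompact_setOf_hamiltonian_le hω hl hβ γ N
  have hγL : 0 ≤ P.γ * T_L := by rw [hγ']; positivity
  have hγR : 0 ≤ P.γ * T_R := by rw [hγ']; positivity
  obtain ⟨M₁, hM₁0, hM₁⟩ := exists_bound_deriv_smoothCutoff
  obtain ⟨M₂, hM₂0, hM₂⟩ := exists_bound_deriv_deriv_smoothCutoff
  set a : Fin N := ⟨0, hN⟩ with ha
  set b : Fin N := ⟨N - 1, Nat.sub_lt hN one_pos⟩ with hb
  set E : PhaseSpace N → ℝ := leftEnergy P N i with hE
  have hEs : ContDiff ℝ ∞ E := contDiff_leftEnergy' P hU hV N i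
  have hR : ∀ n : ℕ, (0 : ℝ) < (n : ℝ) + 1 := fun n => by positivity
  have hR1 : ∀ n : ℕ, (1 : ℝ) ≤ (n : ℝ) + 1 := fun n => by
    have : (0 : ℝ) ≤ n := Nat.cast_nonneg n
    linarith
  -- the test functions `g_n = E_{≤i} χ(H/(n+1))`
  set g : ℕ → PhaseSpace N → ℝ := fun n y =>
    E y * smoothCutoff (P.hamiltonian N y / ((n : ℝ) + 1)) with hg
  have hgs : ∀ n, ContDiff ℝ ∞ (g n) := fun n =>
    hEs.mul (contDiff_smoothCutoff.comp (hHs.div_const _))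
  have hgc : ∀ n, HasCompactSupport (g n) := by
    intro n
    refine HasCompactSupport.intro (hcpt (2 * ((n : ℝ) + 1))) fun x hx => ?_
    simp only [mem_setOf_eq, not_le] at hx
    have h2 : 2 ≤ P.hamiltonian N x / ((n : ℝ) + 1) := by rw [le_div_iff₀ (hR n)]; linarith
    simp only [hg]
    rw [smoothCutoff_of_two_le h2, mul_zero]
  have hginv : ∀ (n : ℕ) (k : Fin N) (x : PhaseSpace N), g n (momentumFlip k x) = g n x := by
    intro n k x
    simp only [hg, hE]
    rw [leftEnergy_momentumFlip, P.hamiltonian_momentumFlip]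
  have hweak : ∀ n : ℕ, ∫ x, P.generator N T_L T_R (g n) x ∂μ = 0 := fun n =>
    integral_generator_eq_zero_of_flipInvariant hμ (hgs n) (hgc n) (hginv n)
  -- the limit integrand and the dominating function
  set F : PhaseSpace N → ℝ := fun x => γ * (T_L - x.2 a ^ 2) - P.bondCurrent N i x with hF
  set Bnd : PhaseSpace N → ℝ := fun x =>
    (γ * (T_L + x.2 a ^ 2) + |P.bondCurrent N i x|) +
      (γ * ((T_L + T_R) * (8 * M₂ + 2 * M₁) + 2 * M₁ * (x.2 a ^ 2 + x.2 b ^ 2)) +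
        M₁ * (2 * γ * T_L * x.2 a ^ 2 + 2 * γ * T_R * x.2 b ^ 2)) with hBnd
  have hia : Integrable (fun x : PhaseSpace N => x.2 a ^ 2) μ :=
    integrable_sq_momentum_left hω hl hβ hγ hN hμ
  have hib : Integrable (fun x : PhaseSpace N => x.2 b ^ 2) μ :=
    integrable_sq_momentum_right hω hl hβ hγ hN hμ
  have hij : Integrable (P.bondCurrent N i) μ := hμ.integrable_bondCurrent i
  have hBndi : Integrable Bnd μ := by
    simp only [hBnd]
    refine ((((integrable_const T_L).add hia).const_mul γ).add hij.abs).add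
      ((((integrable_const _).add ((hia.add hib).const_mul _)).const_mul γ).add
        (((hia.const_mul _).add (hib.const_mul _)).const_mul M₁))
  -- pointwise: closed form, bound, limit
  have hclosed : ∀ (n : ℕ) (x : PhaseSpace N), P.generator N T_L T_R (g n) x = _ :=
    fun n x => generator_leftEnergy_cutoff P hN hγL hγR hU2 hV2 hi ((n : ℝ) + 1) x
  have hsqL : Real.sqrt (2 * γ * T_L) ^ 2 = 2 * γ * T_L := Real.sq_sqrt (by positivity)
  have hsqR : Real.sqrt (2 * γ * T_R) ^ 2 = 2 * γ * T_R := Real.sq_sqrt (by positivity)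
  have hw : ∀ k : Fin N, 0 ≤ blockWeight i k ∧ blockWeight i k ≤ 1 := fun k => by
    unfold blockWeight; split_ifs <;> norm_num
  have hbound : ∀ (n : ℕ) (x : PhaseSpace N), |P.generator N T_L T_R (g n) x| ≤ Bnd x := by
    intro n x
    rw [hclosed n x, hγ', hsqL, hsqR]
    set R : ℝ := (n : ℝ) + 1 with hRdef
    set χv := smoothCutoff (P.hamiltonian N x / R) with hχv
    set d := deriv smoothCutoff (P.hamiltonian N x / R) with hd
    set dd := deriv (deriv smoothCutoff) (P.hamiltonian N x / R) with hdd
    have hRpos : 0 < R := hR n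
    -- the elementary bounds
    have h1a : |E x * (dd / R ^ 2 * x.2 a ^ 2)| ≤ 8 * M₂ :=
      abs_leftEnergy_mul_dd_mul_sq_le P hU0 hV0 hM₂0 hM₂ hRpos i a x
    have h1b : |E x * (dd / R ^ 2 * x.2 b ^ 2)| ≤ 8 * M₂ :=
      abs_leftEnergy_mul_dd_mul_sq_le P hU0 hV0 hM₂0 hM₂ hRpos i b x
    have h2 : |E x * (d / R)| ≤ 2 * M₁ := abs_leftEnergy_mul_d_le P hU0 hV0 hM₁0 hM₁ hRpos i x
    have h3 : |d / R| ≤ M₁ := by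
      rw [abs_div, abs_of_pos hRpos]
      exact (div_le_self (abs_nonneg _) (hR1 n)).trans (hM₁ _)
    have hχ1 : |χv| ≤ 1 := abs_smoothCutoff_le_one _
    have hpa : 0 ≤ x.2 a ^ 2 := sq_nonneg _
    have hpb : 0 ≤ x.2 b ^ 2 := sq_nonneg _
    obtain ⟨hwa0, hwa1⟩ := hw a
    obtain ⟨hwb0, hwb1⟩ := hw b
    -- two-sided versions
    obtain ⟨h1a₁, h1a₂⟩ := abs_le.mp h1a
    obtain ⟨h1b₁, h1b₂⟩ := abs_le.mp h1b
    obtain ⟨h2₁, h2₂⟩ := abs_le.mp h2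
    obtain ⟨h3₁, h3₂⟩ := abs_le.mp h3
    obtain ⟨hχ₁, hχ₂⟩ := abs_le.mp hχ1
    -- the main term
    have hmain : |χv * (γ * (T_L - x.2 a ^ 2) - P.bondCurrent N i x)| ≤
        γ * (T_L + x.2 a ^ 2) + |P.bondCurrent N i x| := by
      rw [abs_mul]
      have hin : |γ * (T_L - x.2 a ^ 2) - P.bondCurrent N i x| ≤
          γ * (T_L + x.2 a ^ 2) + |P.bondCurrent N i x| := by
        refine (abs_sub _ _).trans (add_le_add ?_ le_rfl)
        rw [abs_mul, abs_of_pos hγ]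
        refine mul_le_mul_of_nonneg_left ((abs_sub _ _).trans ?_) hγ.le
        rw [abs_of_nonneg hTL, abs_of_nonneg hpa]
      calc |χv| * |γ * (T_L - x.2 a ^ 2) - P.bondCurrent N i x|
          ≤ 1 * (γ * (T_L + x.2 a ^ 2) + |P.bondCurrent N i x|) :=
            mul_le_mul hχ1 hin (abs_nonneg _) zero_le_one
        _ = _ := one_mul _
    -- the carré-du-champ term: `0 ≤ S ≤ 2γT_L p_0² + 2γT_R p_{N-1}²`
    have eSa : x.2 a * (blockWeight i a * x.2 a) = blockWeight i a * x.2 a ^ 2 := by ring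
    have eSb : x.2 b * (blockWeight i b * x.2 b) = blockWeight i b * x.2 b ^ 2 := by ring
    have hA0 : 0 ≤ 2 * γ * T_L * x.2 a ^ 2 := by positivity
    have hB0 : 0 ≤ 2 * γ * T_R * x.2 b ^ 2 := by positivity
    have hSa0 : 0 ≤ 2 * γ * T_L * x.2 a ^ 2 * blockWeight i a := mul_nonneg hA0 hwa0
    have hSb0 : 0 ≤ 2 * γ * T_R * x.2 b ^ 2 * blockWeight i b := mul_nonneg hB0 hwb0
    have hSa1 : 2 * γ * T_L * x.2 a ^ 2 * blockWeight i a ≤ 2 * γ * T_L * x.2 a ^ 2 :=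
      mul_le_of_le_one_right hA0 hwa1
    have hSb1 : 2 * γ * T_R * x.2 b ^ 2 * blockWeight i b ≤ 2 * γ * T_R * x.2 b ^ 2 :=
      mul_le_of_le_one_right hB0 hwb1
    have e3 : |d / R * (2 * γ * T_L * (x.2 a * (blockWeight i a * x.2 a)) +
        2 * γ * T_R * (x.2 b * (blockWeight i b * x.2 b)))| ≤
        M₁ * (2 * γ * T_L * x.2 a ^ 2 + 2 * γ * T_R * x.2 b ^ 2) := by
      have eS : 2 * γ * T_L * (x.2 a * (blockWeight i a * x.2 a)) +
          2 * γ * T_R * (x.2 b * (blockWeight i b * x.2 b)) =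
          2 * γ * T_L * x.2 a ^ 2 * blockWeight i a + 2 * γ * T_R * x.2 b ^ 2 * blockWeight i b := by
        ring
      rw [eS, abs_mul, abs_of_nonneg (add_nonneg hSa0 hSb0)]
      exact mul_le_mul h3 (add_le_add hSa1 hSb1) (add_nonneg hSa0 hSb0) hM₁0
    -- products with signs (all linear in the monomials afterwards)
    have e2a : |E x * (d / R) * x.2 a ^ 2| ≤ 2 * M₁ * x.2 a ^ 2 := by
      rw [abs_mul, abs_of_nonneg hpa]; exact mul_le_mul_of_nonneg_right h2 hpa
    have e2b : |E x * (d / R) * x.2 b ^ 2| ≤ 2 * M₁ * x.2 b ^ 2 := by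
      rw [abs_mul, abs_of_nonneg hpb]; exact mul_le_mul_of_nonneg_right h2 hpb
    obtain ⟨hm₁, hm₂⟩ := abs_le.mp hmain
    obtain ⟨e2a₁, e2a₂⟩ := abs_le.mp e2a
    obtain ⟨e2b₁, e2b₂⟩ := abs_le.mp e2b
    obtain ⟨e3₁, e3₂⟩ := abs_le.mp e3
    have hγTL : 0 ≤ γ * T_L := by positivity
    have hγTR : 0 ≤ γ * T_R := by positivity
    have t1a := mul_le_mul_of_nonneg_left h1a₂ hγTL
    have t1a' := mul_le_mul_of_nonneg_left h1a₁ hγTL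
    have t1b := mul_le_mul_of_nonneg_left h1b₂ hγTR
    have t1b' := mul_le_mul_of_nonneg_left h1b₁ hγTR
    have t2L := mul_le_mul_of_nonneg_left h2₂ hγTL
    have t2L' := mul_le_mul_of_nonneg_left h2₁ hγTL
    have t2R := mul_le_mul_of_nonneg_left h2₂ hγTR
    have t2R' := mul_le_mul_of_nonneg_left h2₁ hγTR
    have t3a := mul_le_mul_of_nonneg_left e2a₂ hγ.le
    have t3a' := mul_le_mul_of_nonneg_left e2a₁ hγ.le
    have t3b := mul_le_mul_of_nonneg_left e2b₂ hγ.le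
    have t3b' := mul_le_mul_of_nonneg_left e2b₁ hγ.le
    simp only [hBnd]
    rw [abs_le]
    constructor
    · linarith
    · linarith
  have hlim : ∀ x, Tendsto (fun n => P.generator N T_L T_R (g n) x) atTop (𝓝 (F x)) := by
    intro x
    refine tendsto_const_nhds.congr' ?_
    filter_upwards [eventually_smoothCutoff_hamiltonian_eq_one P x,
      eventually_deriv_smoothCutoff_hamiltonian_eq_zero P x,
      eventually_deriv_deriv_smoothCutoff_hamiltonian_eq_zero P x] with n h0 h1 h2
    rw [hclosed n x, h0, h1, h2, hγ']
    simp only [hF]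
    ring
  -- dominated convergence
  have hDCT := tendsto_integral_of_dominated_convergence Bnd
    (fun n => ((P.continuous_generator hU1 hV1 N T_L T_R ((hgs n).of_le (by norm_cast))).aestronglyMeasurable))
    hBndi (fun n => Eventually.of_forall fun x => by rw [Real.norm_eq_abs]; exact hbound n x)
    (Eventually.of_forall hlim)
  have h0 : ∫ x, F x ∂μ = 0 := by
    have h := hDCT
    simp only [hweak] at h
    exact tendsto_nhds_unique h tendsto_const_nhds
  simp only [hF] at h0
  rw [integral_sub (((integrable_const T_L).sub' hia).const_mul γ) hij, integral_const_mul,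
    integral_sub (integrable_const T_L) hia, integral_const, probReal_univ, one_smul] at h0
  linarith

/-- **Total current of a weak flip steady state** (same setting): `totalCurrent μ = (N − 1) γ (T_L − ∫ p_0² dμ)`
— all `N − 1` genuine bonds carry the left reservoir flux, the last index carries no bond
(`OscillatorChain.totalCurrent_eq_of_forall`). [Bonetto–Lebowitz–Rey-Bellet 2000, §5.2 eq. (27)] [folklore] -/
theorem totalCurrent_eq_left (hω : 0 < ω₂) (hl : 0 ≤ lam) (hβ : 0 ≤ β) (hγ : 0 < γ) (hN : 0 < N)
    {T_L T_R : ℝ} (hTL : 0 ≤ T_L) (hTR : 0 ≤ T_R) {ε : ℝ} {μ : Measure (PhaseSpace N)}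
    (hμ : (pinnedChain ω₂ lam β γ).IsFlipSteadyState N T_L T_R ε μ) :
    (pinnedChain ω₂ lam β γ).totalCurrent μ = ((N : ℝ) - 1) * γ * (T_L - ∫ x, x.2 ⟨0, hN⟩ ^ 2 ∂μ) := by
  obtain ⟨M, rfl⟩ : ∃ M, N = M + 1 := ⟨N - 1, by omega⟩
  rw [(pinnedChain ω₂ lam β γ).totalCurrent_eq_of_forall μ (γ * (T_L - ∫ x, x.2 ⟨0, hN⟩ ^ 2 ∂μ))
    fun i hi => integral_bondCurrent_eq hω hl hβ hγ hN hTL hTR hμ hi]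
  push_cast
  ring

/-- **… and in the right-end form**: `totalCurrent μ = (N − 1) γ (∫ p_{N-1}² dμ − T_R)` (file 2/3: the two end
kinetic temperatures add up to `T_L + T_R`). [Bonetto–Lebowitz–Rey-Bellet 2000, §5.2 eqs. (25)–(27)] [folklore] -/
theorem totalCurrent_eq_right (hω : 0 < ω₂) (hl : 0 ≤ lam) (hβ : 0 ≤ β) (hγ : 0 < γ) (hN : 0 < N)
    {T_L T_R : ℝ} (hTL : 0 ≤ T_L) (hTR : 0 ≤ T_R) {ε : ℝ} {μ : Measure (PhaseSpace N)}
    (hμ : (pinnedChain ω₂ lam β γ).IsFlipSteadyState N T_L T_R ε μ) :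
    (pinnedChain ω₂ lam β γ).totalCurrent μ =
      ((N : ℝ) - 1) * γ * ((∫ x, x.2 ⟨N - 1, Nat.sub_lt hN one_pos⟩ ^ 2 ∂μ) - T_R) := by
  rw [totalCurrent_eq_left hω hl hβ hγ hN hTL hTR hμ]
  have h := integral_sq_momentum_ends hω hl hβ hγ hN hμ
  have e : T_L - ∫ x, x.2 ⟨0, hN⟩ ^ 2 ∂μ = (∫ x, x.2 ⟨N - 1, Nat.sub_lt hN one_pos⟩ ^ 2 ∂μ) - T_R := by
    linarith
  rw [e]

/-- **Registered sub-goal `stubS3_flipBondCurrents`** (brick for stub S3 `stub_noisyPositiveConductance` of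
crux stmt-AtomisticToContinuum-11976): bond and total currents of every weak flip steady state of the pinned
chain (`ω₂ > 0`, `lam, β ≥ 0`, `γ > 0`, `N ≥ 1`, `T_L, T_R ≥ 0`, any rate, NO moment hypothesis) in terms of
the left-end kinetic temperature: `∫ j_i dμ = γ(T_L − ∫p_0²)` for every genuine bond and
`totalCurrent μ = (N − 1) γ (T_L − ∫ p_0² dμ)`. [Bonetto–Lebowitz–Rey-Bellet 2000, §5.2 eqs. (25)–(27)] [folklore] -/
theorem stubS3_flipBondCurrents :
    ∀ ω₂ lam β γ : ℝ, 0 < ω₂ → 0 ≤ lam → 0 ≤ β → 0 < γ →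
      ∀ (N : ℕ) (hN : 0 < N) (T_L T_R : ℝ), 0 ≤ T_L → 0 ≤ T_R →
        ∀ (ε : ℝ) (μ : Measure (PhaseSpace N)),
          (pinnedChain ω₂ lam β γ).IsFlipSteadyState N T_L T_R ε μ →
            (∀ i : Fin N, i.val + 1 < N →
              ∫ x, (pinnedChain ω₂ lam β γ).bondCurrent N i x ∂μ = γ * (T_L - ∫ x, x.2 ⟨0, hN⟩ ^ 2 ∂μ)) ∧
            (pinnedChain ω₂ lam β γ).totalCurrent μ =
              ((N : ℝ) - 1) * γ * (T_L - ∫ x, x.2 ⟨0, hN⟩ ^ 2 ∂μ) :=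
  fun _ _ _ _ hω hl hβ hγ _ hN _ _ hTL hTR _ _ hμ =>
    ⟨fun _ hi => integral_bondCurrent_eq hω hl hβ hγ hN hTL hTR hμ hi,
      totalCurrent_eq_left hω hl hβ hγ hN hTL hTR hμ⟩

end Pinned

end Summit.AtomisticToContinuum.FouriersLaw.Theorems.VanishingNoiseBound

end
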